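/-
Copyright: publication-cell `pub-balaban` (b2b), seat b2b-balaban-b10 gen 19 (v1).  Literature leaf — the algebra of the
exponential map in a C⋆-algebra (unitaries, skew-adjoint generators) and one-variable complex differentiability only;
every theorem is kernel-proved and tagged [folklore] or [cite: …] (a LOCATED printed shape); the `def`s are MODEL
OBJECTS (a tube around the unitaries, an exponential line), consumed by the hypothesis shapes of `…B10Eq61PerSite` and
never asserted to be Bałaban's; NO new cited facts, NO summit vocabulary.
-/
import Mathlib
import Literature.MathematicalPhysics.QuantumFieldTheory.Balaban1983to89.B10Eq61PerSite

/-!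
# `Balaban1983to89.B10Eq29TubeLine` — [Balaban1985UV3] (28)–(29) p. 263: the complex line `ζ ↦ exp iζη𝓗(B)`
# STAYS IN THE ANALYTICITY TUBE `U = exp(B)·U′` ([5] (3.37), [I] (1.13)) on a strip of half-width
# (complex half-width of the tube)/(size of the generator), and every function holomorphic on the tube is
# holomorphic along it — the leaves (L1′)/(L2′) (and (L1)/(L2)) of `B10Eq61PerSite` DISCHARGED in the C⋆-algebra model

T. Bałaban, *Ultraviolet stability of three-dimensional lattice pure gauge field theories*, Commun. Math. Phys. **102**,
255–275 (1985) [Balaban1985UV3] (cell paper B10; PDF `paper:balaban1985-cmp102-uv-stability-3d`, journal page = PDF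
page + 254).  The printed analyticity spaces: T. Bałaban, *Propagators for lattice gauge theories in a background
field*, Commun. Math. Phys. **99**, 389–434 (1985) [Balaban1985BackgroundPropagators] = [5] of the paper, (3.35)/(3.37)
p. 396; T. Bałaban, *Renormalization group approach to lattice gauge field theories. I*, Commun. Math. Phys. **109**,
249–301 (1987) [Balaban1987RG1] = [I], (1.11)–(1.13) p. 262; *… II*, Commun. Math. Phys. **116**, 1–22 (1988)
[Balaban1988RG2Cluster] = [II], p. 15.  All quotations in §0 are those already read off the renders for
`…B10Eq61PerSite` §0 (v1.1, gens 17–18; renders `1985-cmp102-uv-stability-3d-p009-x2.png` = p. 263,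
`1985-cmp99-background-propagators-p008-x2.png` = p. 396, `1987-cmp109-rg-I-small-field-p014-x2.png` = p. 262,
`1988-cmp116-rg-II-cluster-p015-x2.png` = p. 15, READ AS IMAGES there); this module adds NO new quotation.
Sibling (imported BY NAME, byte-identical): `…B10Eq61PerSite` (the leaves `LineInStrip` (L1′), `AnalyticOnStrip`
(L2′), `DerivZeroAlongV` (L3′), `LineInDomain` (L1), `AnalyticAlong` (L2); `Rect`, `diffAlongV`, `inv_halfWidth_le`,
`logHalfBound_diffAlongV_of_derivZero`, `logHalfBound_secondOrder_of_R21`, `bound118_secondOrder_of_R21`).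

WHY THIS MODULE (the b10 lineage's open edge after v1.1 of `B10Eq61PerSite`; cell GAPS C-b10g18-1, G-B13-12a UPDATE
(b10-g18), C-adv2-65, C-pv03-49).  `B10Eq61PerSite` derives the per-cube smallness of the `U_{k+1} = 1` subtraction (61)
from three LEAVES about the complex line `ζ ↦ exp iζη𝓗(B)` of (29): (L1′) the line stays in the analyticity space on
a strip `Rect (h X)` of X-dependent half-width, (L2′) every localized term is holomorphic along it, (L3′) no first-order
term (the (32)-shape).  Its §3b located the SHAPE of the half-width — `h_X ≈ a/(p + q·(1 + d_{k+1}(X)))`, binding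
constraint the IMAGINARY direction of ζ (where the real potential becomes a complex part, bounded in the big space by
`α′₁` with no factor LM, [I] (1.13), [II] p. 15), the real direction free — but only in prose (`inv_halfWidth_le` is
the arithmetic of that shape, not its derivation).  This module is the KERNEL FORM of that derivation in a MODEL: the
bond variables take values in a unital C⋆-algebra `𝔸` (e.g. `M_N(ℂ)` with the operator norm, `G = U(N)` = the unitary
group of `𝔸`, as everywhere in the cell, cf. `…B7Prop2Explicit` §6), the printed tube `U = U′U`, `U′ = e^{iηA′}`,
`|A′| < α₁`, `U ∈ G` ([5] (3.37); [I] (1.13) `U′ = exp iξA′`, `|A′| < α₁`) is the set `Tube 𝔸 α = {exp(B)·U : ‖B‖ < α,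
U unitary}`, and the printed line (29) `exp iζη𝓗(B)` with `𝓗(B)` REAL (p. 263: `U₁` is a G-valued configuration, the
gauge `exp i𝓗(B)` has `i𝓗(B)` in the Lie algebra) is `ζ ↦ exp(ζ·K)·U₀` with `K` SKEW-ADJOINT (`= iη𝓗(B)` at one bond)
and `U₀` unitary.  THE POINT (§1, `exp_smul_mul_mem_tube`): `exp(ζK)U₀ = exp((Im ζ)·iK) · (exp((Re ζ)·K)·U₀)` with the
second factor UNITARY for every real part of ζ (Mathlib `NormedSpace.exp_mem_unitary_of_mem_skewAdjoint`) and the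
first of norm-exponent `|Im ζ|·‖K‖` — so the line lies in `Tube 𝔸 α` exactly when `|Im ζ|·‖K‖ < α`: on the strip
`|Im ζ| < α/κ` if `‖K‖ ≤ κ`, for ALL `Re ζ` — the kernel form of "binding constraint = imaginary direction, real
direction free", i.e. of the slot structure of `inv_halfWidth_le` (`a` = α the complex half-width of the tube, the
denominator = the size κ_X of the generator over the localization domain, which for the print grows like
`c₀·LM·B·α₀·(1 + d_{k+1}(X))`, [I] (1.12)).  With it, (L1′) holds for lines of the printed kind as soon as the
analyticity space CONTAINS the tube (§3, `lineInStrip_expLine`), and (L2′) follows from (L1′) by the chain rule as soon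
as the localized terms are holomorphic on the analyticity space (§3, `analyticOnStrip_expLine`; the line itself is
ENTIRE, §2) — which is what the paper imports BY REFERENCE (p. 263: *"The third property is the analyticity with
respect to U₁. These properties follow from the results of previous papers"*; [II] p. 15).  §4 re-exports the
second-order theorems of `B10Eq61PerSite` with (L1′)+(L2′) so discharged: the remaining binders are the holomorphy of
the terms on a space containing the tube, the potential bound `κ_X`, the leaf (L3′) (owned by the b13 lineage, cell
journal 2026-08-19T07:26:57Z; not discharged here) and the undifferenced bound.  §7 records that the paper's own
`G = U(N) ⊂ M_N(ℂ)` with the operator norm is an instance of the model.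

CITATION HEADER (lean-in-tree rule).  WHAT IS REPRODUCED (verbatim, §0): [Balaban1985UV3] p. 263 (the gauge
`exp i𝓗(B)`, (28), (29)); [Balaban1985BackgroundPropagators] p. 396 ((3.35), (3.37)); [Balaban1987RG1] p. 262
((1.11)–(1.13)); [Balaban1988RG2Cluster] p. 15 (the three analyticity spaces) — all already in `B10Eq61PerSite` §0.

WHAT IS KERNEL-CERTIFIED (algebra of `exp` in a C⋆-algebra, one-variable complex differentiability, real arithmetic —
no object of the papers is constructed):
* §1 [folklore] — THE TUBE `Tube 𝔸 α := {V | ∃ B U, ‖B‖ < α ∧ U ∈ unitary 𝔸 ∧ V = exp B * U}`; unitaries lie in every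
  tube of positive half-width (`mem_tube_of_mem_unitary`); real multiples of a skew-adjoint `K` are skew-adjoint and
  their exponentials unitary (`ofReal_smul_mem_skewAdjoint`, `exp_ofReal_smul_mem_unitary`); THE POINT
  `exp_smul_mul_mem_tube`: `K` skew-adjoint, `U₀` unitary, `|Im ζ|·‖K‖ < α` ⇒ `exp(ζ • K) * U₀ ∈ Tube 𝔸 α`; hence on
  the strip `ζ ∈ Rect (α/κ)` when `‖K‖ ≤ κ` (`exp_smul_mul_mem_tube_of_mem_rect`, EVERY real part allowed by `Rect`
  is harmless) and on the disc `‖ζ‖ < α/κ` (`exp_smul_mul_mem_tube_of_mem_ball`).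
* §2 [folklore] — CONFIGURATIONS on a type of bonds `ι` with values in `𝔸`: the bondwise tube `TubeCfg ι 𝔸 α`, the
  exponential line `expLine gen base X φ ζ = fun b => exp(ζ • gen X φ b) * base X φ b` (X-dependent generator and base
  point, as the gauge of p. 263 lives on a neighbourhood `□₁` of the localization domain), its X-independent variant
  `expLine₀`; the line is ENTIRE in ζ (`differentiable_expLine`, Mathlib `hasDerivAt_exp_smul_const`) and lies in
  `TubeCfg ι 𝔸 α` on `Rect (α/κ)` when the generator is bondwise skew-adjoint of norm `≤ κ` and the base point
  bondwise unitary (`expLine_mem_tubeCfg`).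
* §3 — THE LEAVES DISCHARGED: (L1′) `lineInStrip_expLine` — generator skew-adjoint with `‖gen X φ b‖ ≤ κ X` on `sp' X`,
  base unitary, `TubeCfg ι 𝔸 α ⊆ sp X` ⇒ `LineInStrip sp' sp (expLine gen base) (fun X => α / κ X)`; (L2′)
  `analyticOnStrip_of_comp` (ANY configuration space: `E X` differentiable on `sp X` + line differentiable + (L1′) ⇒
  (L2′), the chain rule) and `analyticOnStrip_expLine`; the disc pair (L1)/(L2) likewise (`lineInDomain_expLine₀`,
  `analyticAlong_expLine₀`).
* §4 — THE SECOND-ORDER THEOREMS WITH (L1′)+(L2′) DISCHARGED: `logHalfBound_expLine_of_derivZero` (generic letters: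
  `‖gen‖ ≤ p + q(1 + d(X))`, tube half-width `a` ⇒ constant `8((p + q)/a)²·B`, rate `r − 2`, via `inv_halfWidth_le` and
  `logHalfBound_diffAlongV_of_derivZero`); in the letters of [II] (`p = α₁`, `q = c₀·LM·α₀`, undifferenced per-LM-cube
  constant `A(LM)⁴`, printed R21): `logHalfBound_secondOrder_expLine_of_R21` (constant `16A(1 + c₀²)/a²`, rate
  `r − 2`) and `bound118_secondOrder_expLine_of_R21` ((I.1.18)-shape, constant `(16A(1 + c₀²)/a²)·c₁`, rate `r − 3`)
  — remaining binders: `gen` skew-adjoint and bounded, `base` unitary, `TubeCfg ι 𝔸 a ⊆ sp X`, `E X` holomorphic on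
  `sp X`, (L3′) `DerivZeroAlongV`, the undifferenced `LogHalfBound`, the volume bound.
* §5 [folklore] — the holomorphy binder is of the resolvent kind: in `𝔸`, `ζ ↦ (T ζ)⁻¹` (`Ring.inverse`) is
  differentiable where `T` is and `T ζ` is a unit (`differentiableAt_inverse_comp`, Mathlib `differentiableAt_inverse`),
  ordered finite products of differentiable `𝔸`-valued functions are differentiable (`differentiableAt_list_prod`),
  and so is any continuous linear functional of them (`differentiableAt_clm_list_prod`) — the shape of one (63)
  random-walk term (a product of local resolvent factors, read through a matrix entry; cf. `…B10Eq63Rep` §5, the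
  continuity version used for the x-integral).
* §6 — NON-VACUITY: with `𝔸 = ℂ`, one bond, generator `(min ‖φ‖ 1)·i`, base point `1`, `E φ = (φ − 1)²`, analyticity
  space = the tube of half-width 1 (on which `‖E‖ ≤ 16`), evaluation space = everything: all binders of
  `logHalfBound_expLine_of_derivZero` hold — incl. (L3′) non-trivially — and the theorem yields the differenced bound
  with constant `8·16` (`example_logHalfBound_expLine`).
* §7 — THE PAPER'S SETTING is an instance: `M_N(ℂ)` with the operator norm (Mathlib scope `Matrix.Norms.L2Operator`,
  as in `…B7Prop2Explicit` §6) is a C⋆-algebra whose unitary group is `U(N)` = `Matrix.unitaryGroup (Fin N) ℂ`, so §1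
  applies to `K ∈ 𝔲(N)` (skew-Hermitian matrices) and `U₀ ∈ U(N)` verbatim (`exp_smul_mul_mem_tube_unitaryGroup`).

HONEST SCOPE.  (i) MODEL, NOT THE PAPER'S OBJECTS: `𝔸` is any unital C⋆-algebra and `Tube 𝔸 α` is the set
`{exp(B)·U}` at ONE bond; the printed spaces [5] (3.35)–(3.37) / [I] (i)–(iii) carry in addition the REAL smallness
(3.35)/(1.11)–(1.12) of `U` (plaquettes `< α₀`, gauge-fixed potentials `< O(1)LMBα₀` per cube, WITH gauge freedom),
derivative conditions `|∇A′| < α₁(L^jη)^{−2}`, the scale-dependent factors `(L^jη)^{−1}`, and the averaging condition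
(iii); none of these is modelled — in the model the real direction is literally free (`U` any unitary), whereas in print
it is free only up to the big-space real bound (`α′₀`, `c₀LMBα′₀`), which the strips `Rect (h X)` (real parts `< 1 + h X`)
respect as long as `(1 + h_X)·κ_X` stays below it — a reading, not a theorem here.  (ii) REAL GENERATOR ONLY: the
factorization `exp(ζK)U₀ = exp((Im ζ)iK)·(unitary)` uses `K` skew-adjoint, i.e. a REAL configuration `U_{k+1}` — the
setting of [Balaban1985UV3] itself ((28) bounds the real `B(c)`); for the d = 4 consumer [II], whose (61)-analogue is
extended *"to analytic functions of 𝐔, 𝐉"* (p. 21), the line passes through COMPLEX configurations (generator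
`K = S + P` with a Hermitian part `P` of size `≲ α₁`): the Hermitian part of `ζK` is then `(Re ζ)P + (Im ζ)·iS`, of
size `≤ (1 + h)α₁ + h·κ_X` on `Rect h`, so the half-width reads `h_X ≈ (α′₁ − α₁)/(α₁ + κ_X)` (this is where the
`p = α₁` slot of `inv_halfWidth_le` comes from), but `S` and `P` no longer commute and the membership in the tube
needs a Duhamel-type estimate for `exp(S′ + P′)` against `exp(P″)·exp(S′)` — NOT covered here; in the model (real
generator) the `p`-slot of §4 is an unused margin, kept to match `logHalfBound_secondOrder_of_R21`'s signature (a bound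
`‖gen‖ ≤ p + q(1 + d)` is a weaker hypothesis than `≤ q(1 + d)`).  (iii) WHICH SPACE (cell GAPS C-adv2-65, adv2-g43): [II] p. 15 names THREE
analyticity spaces — the potentials' `Uᶜ_{k+1}(X, α₀, α₁)` ((1+β)-margins), the covariances' big space I.(i)–(iii)
with `α′₀, α′₁` *"much bigger"*, the activities' `α₀, α₁` — and the absolute second-order constant of
`B10Eq61PerSite` §3b needs the (63)-terms TOGETHER WITH their per-cube bound `A(LM)⁴` on the COVARIANCE space (ii)
(natural reading — the (63)-terms are built of covariances — but not printed), with `a = α′₁` α-, L-, M-independent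
(absolute only under the unprinted `LM·α₀ ≲ α₁` if `a = βα₁` instead); in this module that is the pair of binders
`TubeCfg ι 𝔸 a ⊆ sp X` + `B13.LogHalfBound D sp E …` ON THE SAME `sp`, and nothing decides it.  (iv) WORDING (cell GAPS
C-pv03-49 R1, pv03-g10): the half-width shape `a/(p + q(1 + d))` is INFERRED from the printed potential bounds ([5]
(3.35)/(3.37), [I] (1.12)/(1.13)), not printed as such; §4's hypotheses `‖gen X φ b‖ ≤ p + q·(1 + d(X))` and
`TubeCfg ι 𝔸 a ⊆ sp X` are exactly the two inferred inputs, now explicit binders.  (v) (L3′) is NOT touched (b13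
lineage); the undifferenced bound, the volume bound, `A`, `a`, `c₀`, `c₁` are hypotheses / parameters; the module is
NOT a proof of (24), (61)–(63), (I.1.18) or Theorem 2, and NOT summit progress — it is the kernel form of the sentence
"the line (29) stays in the tube (3.37) on a strip whose width is set by the imaginary direction" plus the chain rule.

## §0. The printed sentences (verbatim; all already in `B10Eq61PerSite` §0, read off the renders there)

[Balaban1985UV3] p. 263: *"According to these there exists a gauge transformation in a neighbourhood of □₁, where □₁
is a cube of the size 3RM₁ and with the same center as □, such that the gauge transformed U₁ is represented as
exp i𝓗(B) in the neighbourhood of □₁. The function 𝓗(B) is represented as 𝓗(B) = HB + A₁"*; *"The characteristic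
functions χ₁ defined in (13) give the restrictions |V(∂p′) − 1| < 2L²g₀p(g₀), hence |B(c)| < 4L²|c₋ − y|g₀p(g₀) <
8L²3R₁M₁r(g₀)g₀p(g₀), (28) and for g₀ sufficiently small the number on the right-hand side above is small."*; *"By
the gauge invariance (26), we have 𝒫′₁(g₀, X, U₁) = 𝒫′₁(g₀, X, exp i𝓗(B)), (29) and we expand the function with
respect to 𝓗(B)."*; *"The third property is the analyticity with respect to U₁. These properties follow from the
results of previous papers"*.
[Balaban1985BackgroundPropagators] p. 396: *"for a configuration U there exists a gauge transformation u on □ such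
that Uᵘ = e^{iηA}, and if the index of □ is j, then |A| < O(1)Mα₀(L^jη)^{−1}, |∇^ηA| < O(1)Mα₀(L^jη)^{−2} on □, where
O(1)M is a size of □ in T_{L^{−j}}; (3.35)"*; *"We assume that they have the form U′U, where U has values in G and
U′ = e^{iηA′}, A′ ∈ gᶜ. For a given pair of positive numbers α₀, α₁ we consider the class of these configurations
satisfying: U satisfies the condition (3.35), and |A′| < α₁(L^jη)^{−1}, |∇^η_U A′| < α₁(L^jη)^{−2} on Ω_j, j = 0, …,
k; (3.37)"*.
[Balaban1987RG1] p. 262: *"(i) 𝐔 = U′U, U has values in the group G, |∂U − 1| < α₀ξ² on X, (1.11) for each cube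
□ ⊂ X of a size O(1)LM there exists a G-valued gauge transformation u defined on □ and such, that Uᵘ = exp iξA, |A|,
|∇^ξA| < O(1)LMBα₀ on □, (1.12) with a sufficiently large constant B (it will be determined later). (ii) U′ =
exp iξA′, A′ has values in the algebra gᶜ, |A′|, |∇^ξ_U A′| < α₁ on X. (1.13)"*.
[Balaban1988RG2Cluster] p. 15: *"The potentials are also analytic functions on the subspace Uᶜ_{k+1}(X, α₀, α₁). The
quadratic forms and covariances in H(Z) are analytic functions on the space of configurations (𝐔, 𝐉) satisfying the
conditions I.(i)–(iii) on the domain Z, with constants α′₀, α′₁ much bigger than α₀, α₁, therefore we can restrict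
them, as analytic functions, to the above subspace."*
-/

noncomputable section

open Metric Set NormedSpace
open scoped Topology ComplexConjugate

namespace Literature.MathematicalPhysics.QuantumFieldTheory.Balaban1983to89.B10Eq29TubeLine

open Literature.MathematicalPhysics.QuantumFieldTheory.Balaban1983to89
open B10Eq61PerSite

/-! ## §1. The tube around the unitaries of a C⋆-algebra and the exponential line -/

section tube

variable (𝔸 : Type*) [CStarAlgebra 𝔸]

/-- THE TUBE (model of [5] (3.37) / [I] (1.13) at one bond): the elements `exp(B)·U` of the C⋆-algebra `𝔸` with
`‖B‖ < α` ("`U′ = e^{iηA′}`, `|A′| < α₁`") and `U` unitary ("`U` has values in G").  The real smallness (3.35)/(1.12)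
of `U` is NOT modelled (HONEST SCOPE (i)). [cite: Balaban1985BackgroundPropagators, (3.37) p.396; Balaban1987RG1, (1.13) p.262] -/
def Tube (α : ℝ) : Set 𝔸 := {V | ∃ B U : 𝔸, ‖B‖ < α ∧ U ∈ unitary 𝔸 ∧ V = exp B * U}

variable {𝔸}

/-- Membership in the tube, unfolded. [folklore] -/
theorem mem_tube {α : ℝ} {V : 𝔸} : V ∈ Tube 𝔸 α ↔ ∃ B U : 𝔸, ‖B‖ < α ∧ U ∈ unitary 𝔸 ∧ V = exp B * U :=
  Iff.rfl

/-- `exp(B)·U` lies in the tube of any half-width `> ‖B‖`. [folklore] -/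
theorem exp_mul_mem_tube {α : ℝ} {B U : 𝔸} (hB : ‖B‖ < α) (hU : U ∈ unitary 𝔸) : exp B * U ∈ Tube 𝔸 α :=
  ⟨B, U, hB, hU, rfl⟩

/-- The unitaries (the real configurations, `A′ = 0`) lie in every tube of positive half-width. [folklore] -/
theorem mem_tube_of_mem_unitary {α : ℝ} (hα : 0 < α) {U : 𝔸} (hU : U ∈ unitary 𝔸) : U ∈ Tube 𝔸 α :=
  ⟨0, U, by simpa using hα, hU, by simp⟩

/-- In particular `1` (the configuration `U_{k+1} = 1`) lies in every tube of positive half-width. [folklore] -/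
theorem one_mem_tube {α : ℝ} (hα : 0 < α) : (1 : 𝔸) ∈ Tube 𝔸 α :=
  mem_tube_of_mem_unitary hα (one_mem _)

/-- Tubes increase with the half-width. [folklore] -/
theorem tube_mono {α α' : ℝ} (h : α ≤ α') : Tube 𝔸 α ⊆ Tube 𝔸 α' :=
  fun _ ⟨B, U, hB, hU, hV⟩ => ⟨B, U, hB.trans_le h, hU, hV⟩

/-- A real multiple of a skew-adjoint element (an element of the Lie algebra of the unitary group, "`iξA`, `A ∈ g`")
is skew-adjoint. [folklore] -/
theorem ofReal_smul_mem_skewAdjoint {K : 𝔸} (hK : K ∈ skewAdjoint 𝔸) (r : ℝ) : (r : ℂ) • K ∈ skewAdjoint 𝔸 := by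
  rw [skewAdjoint.mem_iff] at hK ⊢
  have hr : star (r : ℂ) = (r : ℂ) := Complex.conj_ofReal r
  rw [star_smul, hr, hK, smul_neg]

/-- The exponential of a real multiple of a skew-adjoint element is unitary ("`exp iξA ∈ G`"; Mathlib
`NormedSpace.exp_mem_unitary_of_mem_skewAdjoint`). [folklore] -/
theorem exp_ofReal_smul_mem_unitary {K : 𝔸} (hK : K ∈ skewAdjoint 𝔸) (r : ℝ) :
    exp ((r : ℂ) • K) ∈ unitary 𝔸 := by
  letI : NormedAlgebra ℚ 𝔸 := NormedAlgebra.restrictScalars ℚ ℂ 𝔸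
  exact exp_mem_unitary_of_mem_skewAdjoint (ofReal_smul_mem_skewAdjoint hK r)

/-- **THE POINT — the line (29) stays in the tube (3.37) exactly as far as its IMAGINARY direction allows.**  For `K`
skew-adjoint (`= iη𝓗(B)` at one bond, `𝓗` real) and `U₀` unitary, `exp(ζ•K)·U₀ = exp((Im ζ)·iK) · (exp((Re ζ)·K)·U₀)`:
the second factor is unitary for EVERY real part, the first has exponent of norm `|Im ζ|·‖K‖`; so `|Im ζ|·‖K‖ < α`
puts the point in `Tube 𝔸 α`.  (Kernel form of "binding constraint = imaginary direction, real direction free" behind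
`B10Eq61PerSite.inv_halfWidth_le`.) [cite: Balaban1985UV3, (29) p.263; Balaban1987RG1, (1.12)–(1.13) p.262] -/
theorem exp_smul_mul_mem_tube {K U₀ : 𝔸} (hK : K ∈ skewAdjoint 𝔸) (hU₀ : U₀ ∈ unitary 𝔸) {ζ : ℂ} {α : ℝ}
    (hζ : |ζ.im| * ‖K‖ < α) : exp (ζ • K) * U₀ ∈ Tube 𝔸 α := by
  letI : NormedAlgebra ℚ 𝔸 := NormedAlgebra.restrictScalars ℚ ℂ 𝔸
  have hsplit : ζ • K = ((ζ.im : ℂ) * Complex.I) • K + (ζ.re : ℂ) • K := by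
    rw [← add_smul]
    congr 1
    rw [add_comm]
    exact (Complex.re_add_im ζ).symm
  have hcomm : Commute (((ζ.im : ℂ) * Complex.I) • K) ((ζ.re : ℂ) • K) :=
    ((Commute.refl K).smul_left _).smul_right _
  refine ⟨((ζ.im : ℂ) * Complex.I) • K, exp ((ζ.re : ℂ) • K) * U₀, ?_, ?_, ?_⟩
  · calc ‖((ζ.im : ℂ) * Complex.I) • K‖ = ‖(ζ.im : ℂ) * Complex.I‖ * ‖K‖ := norm_smul _ _
        _ = |ζ.im| * ‖K‖ := by rw [norm_mul, Complex.norm_I, mul_one, Complex.norm_real, Real.norm_eq_abs]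
        _ < α := hζ
  · exact mul_mem (exp_ofReal_smul_mem_unitary hK ζ.re) hU₀
  · rw [hsplit, exp_add_of_commute hcomm, mul_assoc]

/-- On the STRIP: `‖K‖ ≤ κ`, `0 < κ`, `ζ ∈ Rect (α/κ)` ⇒ `|Im ζ|·‖K‖ < α` — the real parts `−α/κ < Re ζ < 1 + α/κ`
allowed by `Rect` play no role. [folklore] -/
theorem abs_im_mul_norm_lt_of_mem_rect {K : 𝔸} {κ α : ℝ} (hκ : 0 < κ) (hKκ : ‖K‖ ≤ κ) {ζ : ℂ}
    (hζ : ζ ∈ Rect (α / κ)) : |ζ.im| * ‖K‖ < α := by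
  rw [mem_rect] at hζ
  obtain ⟨h1, h2, -, -⟩ := hζ
  have him : |ζ.im| < α / κ := abs_lt.mpr ⟨h1, h2⟩
  have hακ : |ζ.im| * κ < α := by
    have := mul_lt_mul_of_pos_right him hκ
    rwa [div_mul_cancel₀ _ hκ.ne'] at this
  calc |ζ.im| * ‖K‖ ≤ |ζ.im| * κ := mul_le_mul_of_nonneg_left hKκ (abs_nonneg _)
    _ < α := hακ

/-- On the DISC: `‖K‖ ≤ κ`, `0 < κ`, `‖ζ‖ < α/κ` ⇒ `|Im ζ|·‖K‖ < α` (`|Im ζ| ≤ ‖ζ‖`). [folklore] -/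
theorem abs_im_mul_norm_lt_of_mem_ball {K : 𝔸} {κ α : ℝ} (hκ : 0 < κ) (hKκ : ‖K‖ ≤ κ) {ζ : ℂ}
    (hζ : ζ ∈ ball (0 : ℂ) (α / κ)) : |ζ.im| * ‖K‖ < α := by
  rw [mem_ball_zero_iff] at hζ
  have him : |ζ.im| < α / κ := (Complex.abs_im_le_norm ζ).trans_lt hζ
  have hακ : |ζ.im| * κ < α := by
    have := mul_lt_mul_of_pos_right him hκ
    rwa [div_mul_cancel₀ _ hκ.ne'] at this
  calc |ζ.im| * ‖K‖ ≤ |ζ.im| * κ := mul_le_mul_of_nonneg_left hKκ (abs_nonneg _)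
    _ < α := hακ

/-- The line stays in the tube on the strip `Rect (α/κ)`. [cite: Balaban1985UV3, (28)–(29) p.263; Balaban1987RG1, (1.13) p.262] -/
theorem exp_smul_mul_mem_tube_of_mem_rect {K U₀ : 𝔸} (hK : K ∈ skewAdjoint 𝔸) (hU₀ : U₀ ∈ unitary 𝔸)
    {κ α : ℝ} (hκ : 0 < κ) (hKκ : ‖K‖ ≤ κ) {ζ : ℂ} (hζ : ζ ∈ Rect (α / κ)) : exp (ζ • K) * U₀ ∈ Tube 𝔸 α :=
  exp_smul_mul_mem_tube hK hU₀ (abs_im_mul_norm_lt_of_mem_rect hκ hKκ hζ)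

/-- The line stays in the tube on the disc `‖ζ‖ < α/κ`. [cite: Balaban1985UV3, (28)–(29) p.263; Balaban1987RG1, (1.13) p.262] -/
theorem exp_smul_mul_mem_tube_of_mem_ball {K U₀ : 𝔸} (hK : K ∈ skewAdjoint 𝔸) (hU₀ : U₀ ∈ unitary 𝔸)
    {κ α : ℝ} (hκ : 0 < κ) (hKκ : ‖K‖ ≤ κ) {ζ : ℂ} (hζ : ζ ∈ ball (0 : ℂ) (α / κ)) :
    exp (ζ • K) * U₀ ∈ Tube 𝔸 α :=
  exp_smul_mul_mem_tube hK hU₀ (abs_im_mul_norm_lt_of_mem_ball hκ hKκ hζ)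

/-- The one-bond line `ζ ↦ exp(ζ•K)·U₀` is ENTIRE (Mathlib `hasDerivAt_exp_smul_const`). [folklore] -/
theorem differentiable_exp_smul_mul (K U₀ : 𝔸) : Differentiable ℂ (fun ζ : ℂ => exp (ζ • K) * U₀) :=
  fun ζ => (hasDerivAt_exp_smul_const K ζ).differentiableAt.mul_const U₀

end tube

/-! ## §2. Configurations: bondwise tube and the exponential line through a configuration -/

section cfg

variable {ι : Type*} {𝔸 : Type*} [CStarAlgebra 𝔸] {D : LocDomainSys}

variable (ι 𝔸) in
/-- The bondwise tube: configurations `ι → 𝔸` every bond variable of which lies in `Tube 𝔸 α` (model of the space of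
configurations `U′U` of [5] (3.37) / [I] (i)–(ii) on a set of bonds `ι`). [cite: Balaban1985BackgroundPropagators, (3.37) p.396; Balaban1987RG1, (1.11)–(1.13) p.262] -/
def TubeCfg (α : ℝ) : Set (ι → 𝔸) := {V | ∀ b, V b ∈ Tube 𝔸 α}

/-- Membership in the bondwise tube, unfolded. [folklore] -/
theorem mem_tubeCfg {α : ℝ} {V : ι → 𝔸} : V ∈ TubeCfg ι 𝔸 α ↔ ∀ b, V b ∈ Tube 𝔸 α := Iff.rfl

/-- Bondwise unitary configurations lie in every bondwise tube of positive half-width. [folklore] -/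
theorem mem_tubeCfg_of_unitary {α : ℝ} (hα : 0 < α) {V : ι → 𝔸} (hV : ∀ b, V b ∈ unitary 𝔸) :
    V ∈ TubeCfg ι 𝔸 α :=
  fun b => mem_tube_of_mem_unitary hα (hV b)

/-- THE EXPONENTIAL LINE through a configuration, X-dependent (model of (29) `ζ ↦ exp iζη𝓗(B)`, the gauge `exp i𝓗(B)`
living on a neighbourhood `□₁` of the localization domain X): bondwise `ζ ↦ exp(ζ • gen X φ b) * base X φ b`, with a
GENERATOR `gen X φ` (for the print: `iη𝓗(B)`, skew-adjoint, of the size (28)) and a BASE POINT `base X φ` (for the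
print: the configuration at `𝓗 = 0`, unitary).  Data of the model; nothing of p. 263's gauge fixing is constructed.
[cite: Balaban1985UV3, (29) p.263; p.271 (before (60))] -/
def expLine (gen base : D.Dom → (ι → 𝔸) → ι → 𝔸) : D.Dom → (ι → 𝔸) → ℂ → ι → 𝔸 :=
  fun X φ ζ b => exp (ζ • gen X φ b) * base X φ b

/-- The X-independent variant (for the disc leaves (L1)/(L2) of `B10Eq61PerSite` §2). [cite: Balaban1985UV3, (29) p.263] -/
def expLine₀ (gen base : (ι → 𝔸) → ι → 𝔸) : (ι → 𝔸) → ℂ → ι → 𝔸 :=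
  fun φ ζ b => exp (ζ • gen φ b) * base φ b

/-- `expLine₀` is `expLine` with constant data. [folklore] -/
theorem expLine_const (gen base : (ι → 𝔸) → ι → 𝔸) :
    expLine (D := D) (fun _ => gen) (fun _ => base) = fun _ => expLine₀ gen base := rfl

/-- At `ζ = 0` the line sits at its base point (the configuration "`U_{k+1} = 1`" of (61) when `base = 1`). [folklore] -/
theorem expLine_zero (gen base : D.Dom → (ι → 𝔸) → ι → 𝔸) (X : D.Dom) (φ : ι → 𝔸) :
    expLine gen base X φ 0 = base X φ := by
  funext b
  simp [expLine]

/-- The line lies in the bondwise tube on the strip `Rect (α/κ)` when the generator is bondwise skew-adjoint of norm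
`≤ κ` and the base point bondwise unitary. [cite: Balaban1985UV3, (28)–(29) p.263; Balaban1987RG1, (1.13) p.262] -/
theorem expLine_mem_tubeCfg {gen base : D.Dom → (ι → 𝔸) → ι → 𝔸} {X : D.Dom} {φ : ι → 𝔸} {κ α : ℝ}
    (hgen : ∀ b, gen X φ b ∈ skewAdjoint 𝔸) (hbase : ∀ b, base X φ b ∈ unitary 𝔸) (hκ : 0 < κ)
    (hbound : ∀ b, ‖gen X φ b‖ ≤ κ) {ζ : ℂ} (hζ : ζ ∈ Rect (α / κ)) :
    expLine gen base X φ ζ ∈ TubeCfg ι 𝔸 α :=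
  fun b => exp_smul_mul_mem_tube_of_mem_rect (hgen b) (hbase b) hκ (hbound b) hζ

/-- Disc version for the X-independent line. [cite: Balaban1985UV3, (28)–(29) p.263; Balaban1987RG1, (1.13) p.262] -/
theorem expLine₀_mem_tubeCfg {gen base : (ι → 𝔸) → ι → 𝔸} {φ : ι → 𝔸} {κ α : ℝ}
    (hgen : ∀ b, gen φ b ∈ skewAdjoint 𝔸) (hbase : ∀ b, base φ b ∈ unitary 𝔸) (hκ : 0 < κ)
    (hbound : ∀ b, ‖gen φ b‖ ≤ κ) {ζ : ℂ} (hζ : ζ ∈ ball (0 : ℂ) (α / κ)) :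
    expLine₀ gen base φ ζ ∈ TubeCfg ι 𝔸 α :=
  fun b => exp_smul_mul_mem_tube_of_mem_ball (hgen b) (hbase b) hκ (hbound b) hζ

/-- The line through a configuration is ENTIRE in `ζ` (bondwise `hasDerivAt_exp_smul_const`). [folklore] -/
theorem differentiable_expLine (gen base : D.Dom → (ι → 𝔸) → ι → 𝔸) (X : D.Dom) (φ : ι → 𝔸) :
    Differentiable ℂ (expLine gen base X φ) :=
  differentiable_pi.mpr fun b => differentiable_exp_smul_mul (gen X φ b) (base X φ b)

/-- The X-independent line is entire. [folklore] -/
theorem differentiable_expLine₀ (gen base : (ι → 𝔸) → ι → 𝔸) (φ : ι → 𝔸) :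
    Differentiable ℂ (expLine₀ gen base φ) :=
  differentiable_pi.mpr fun b => differentiable_exp_smul_mul (gen φ b) (base φ b)

end cfg

/-! ## §3. The leaves (L1′)/(L2′) and (L1)/(L2) of `B10Eq61PerSite` discharged for exponential lines -/

section leaves

variable {D : LocDomainSys}

/-- **(L2′) FROM (L1′) BY THE CHAIN RULE**, for ANY configuration space: if each `E X` is (complex-)differentiable on
the analyticity space `sp X`, each line is differentiable, and the lines stay in `sp X` on the strips (L1′), then every
term is holomorphic along the lines on the strips (L2′).  This is all that "analyticity with respect to U₁" (p. 263,
imported from the previous papers) has to supply for `B10Eq61PerSite`. [cite: Balaban1985UV3, p.263 (before (27))] -/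
theorem analyticOnStrip_of_comp {Φ : Type*} [NormedAddCommGroup Φ] [NormedSpace ℂ Φ] {sp' sp : D.Dom → Set Φ}
    {E : D.Dom → Φ → ℂ} {line : D.Dom → Φ → ℂ → Φ} {h : D.Dom → ℝ}
    (hE : ∀ X, DifferentiableOn ℂ (E X) (sp X)) (hline : ∀ X φ, φ ∈ sp' X → Differentiable ℂ (line X φ))
    (hdom : LineInStrip sp' sp line h) : AnalyticOnStrip sp' E line h :=
  fun X φ hφ => (hE X).comp (hline X φ hφ).differentiableOn fun ζ hζ => hdom X φ hφ ζ hζ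

/-- The disc version: (L2) from (L1) by the chain rule. [cite: Balaban1985UV3, p.263 (before (27))] -/
theorem analyticAlong_of_comp {Φ : Type*} [NormedAddCommGroup Φ] [NormedSpace ℂ Φ] {sp' sp : D.Dom → Set Φ}
    {E : D.Dom → Φ → ℂ} {line : Φ → ℂ → Φ} {ρ : ℝ}
    (hE : ∀ X, DifferentiableOn ℂ (E X) (sp X)) (hline : ∀ X φ, φ ∈ sp' X → Differentiable ℂ (line φ))
    (hdom : LineInDomain sp' sp line ρ) : AnalyticAlong sp' E line ρ :=
  fun X φ hφ => (hE X).comp (hline X φ hφ).differentiableOn fun ζ hζ => hdom X φ hφ ζ hζ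

variable {ι : Type*} {𝔸 : Type*} [CStarAlgebra 𝔸]

/-- **(L1′) DISCHARGED for exponential lines**: on the evaluation spaces `sp' X` let the generator be bondwise
skew-adjoint with `‖gen X φ b‖ ≤ κ X` (the size of `η𝓗(B)` over the localization domain, (28); for [I]:
`O(1)LMBα₀·(1 + d_{k+1}(X))`) and the base point bondwise unitary, and let the analyticity space `sp X` CONTAIN the
bondwise tube of complex half-width `α` ([II] p. 15: the covariances are analytic on the big space I.(i)–(iii), `α′₁`);
then the lines stay in `sp X` on the strips `Rect (α / κ X)`. [cite: Balaban1985UV3, (28)–(29) p.263; Balaban1988RG2Cluster, p.15] -/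
theorem lineInStrip_expLine {sp' sp : D.Dom → Set (ι → 𝔸)} {gen base : D.Dom → (ι → 𝔸) → ι → 𝔸}
    {κ : D.Dom → ℝ} {α : ℝ} (hgen : ∀ X φ, φ ∈ sp' X → ∀ b, gen X φ b ∈ skewAdjoint 𝔸)
    (hbase : ∀ X φ, φ ∈ sp' X → ∀ b, base X φ b ∈ unitary 𝔸) (hκ : ∀ X, 0 < κ X)
    (hbound : ∀ X φ, φ ∈ sp' X → ∀ b, ‖gen X φ b‖ ≤ κ X) (hsp : ∀ X, TubeCfg ι 𝔸 α ⊆ sp X) :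
    LineInStrip sp' sp (expLine gen base) (fun X => α / κ X) :=
  fun X φ hφ _ hζ => hsp X (expLine_mem_tubeCfg (hgen X φ hφ) (hbase X φ hφ) (hκ X) (hbound X φ hφ) hζ)

/-- **(L1) DISCHARGED** (disc, X-independent line, one size `κ`): radius `α / κ`. [cite: Balaban1985UV3, (28)–(29) p.263; Balaban1988RG2Cluster, p.15] -/
theorem lineInDomain_expLine₀ {sp' sp : D.Dom → Set (ι → 𝔸)} {gen base : (ι → 𝔸) → ι → 𝔸} {κ α : ℝ}
    (hgen : ∀ X φ, φ ∈ sp' X → ∀ b, gen φ b ∈ skewAdjoint 𝔸)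
    (hbase : ∀ X φ, φ ∈ sp' X → ∀ b, base φ b ∈ unitary 𝔸) (hκ : 0 < κ)
    (hbound : ∀ X φ, φ ∈ sp' X → ∀ b, ‖gen φ b‖ ≤ κ) (hsp : ∀ X, TubeCfg ι 𝔸 α ⊆ sp X) :
    LineInDomain sp' sp (expLine₀ gen base) (α / κ) :=
  fun X φ hφ _ hζ => hsp X (expLine₀_mem_tubeCfg (hgen X φ hφ) (hbase X φ hφ) hκ (hbound X φ hφ) hζ)

variable [Fintype ι]

/-- **(L2′) DISCHARGED for exponential lines**: terms holomorphic on the analyticity spaces + (L1′) ⇒ (L2′).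
[cite: Balaban1985UV3, p.263 (before (27)); Balaban1988RG2Cluster, p.15] -/
theorem analyticOnStrip_expLine {sp' sp : D.Dom → Set (ι → 𝔸)} {E : D.Dom → (ι → 𝔸) → ℂ}
    {gen base : D.Dom → (ι → 𝔸) → ι → 𝔸} {h : D.Dom → ℝ} (hE : ∀ X, DifferentiableOn ℂ (E X) (sp X))
    (hdom : LineInStrip sp' sp (expLine gen base) h) : AnalyticOnStrip sp' E (expLine gen base) h :=
  analyticOnStrip_of_comp hE (fun X φ _ => differentiable_expLine gen base X φ) hdom

/-- **(L2) DISCHARGED** (disc, X-independent line). [cite: Balaban1985UV3, p.263 (before (27)); Balaban1988RG2Cluster, p.15] -/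
theorem analyticAlong_expLine₀ {sp' sp : D.Dom → Set (ι → 𝔸)} {E : D.Dom → (ι → 𝔸) → ℂ}
    {gen base : (ι → 𝔸) → ι → 𝔸} {ρ : ℝ} (hE : ∀ X, DifferentiableOn ℂ (E X) (sp X))
    (hdom : LineInDomain sp' sp (expLine₀ gen base) ρ) : AnalyticAlong sp' E (expLine₀ gen base) ρ :=
  analyticAlong_of_comp hE (fun _ φ _ => differentiable_expLine₀ gen base φ) hdom

end leaves

/-! ## §4. The second-order theorems of `B10Eq61PerSite` with (L1′)+(L2′) discharged -/

section secondOrder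

variable {D : LocDomainSys} {ι : Type*} [Fintype ι] {𝔸 : Type*} [CStarAlgebra 𝔸]
  {sp' sp : D.Dom → Set (ι → 𝔸)} {E : D.Dom → (ι → 𝔸) → ℂ} {gen base : D.Dom → (ι → 𝔸) → ι → 𝔸}
  {nX : D.Dom → ℕ}

/-- **THE SUBTRACTION (61) AT SECOND ORDER ALONG EXPONENTIAL LINES, generic letters.**  Generator skew-adjoint with
`‖gen X φ b‖ ≤ p + q·(1 + d(X))` on `sp' X` (`p, q ≥ 0`, `p + q > 0`), base point unitary, analyticity space
containing the bondwise tube of complex half-width `a > 0`, terms holomorphic on it and obeying the undifferenced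
per-cube bound `B` at rate `r`, and (L3′): then the differenced family obeys the per-cube shape with constant
`8·((p + q)/a)²·B` at rate `r − 2` — `B10Eq61PerSite.logHalfBound_diffAlongV_of_derivZero` with the half-width
`h X = a/(p + q(1 + d(X)))` SUPPLIED (`lineInStrip_expLine`, `analyticOnStrip_expLine`, `inv_halfWidth_le`) instead of
assumed. [cite: Balaban1985UV3, p.272 (after (63)); (28)–(29) p.263; (32) p.264] -/
theorem logHalfBound_expLine_of_derivZero {B r a p q : ℝ} (ha : 0 < a) (hp : 0 ≤ p) (hq : 0 ≤ q)
    (hpq : 0 < p + q) (hB : 0 ≤ B) (hgen : ∀ X φ, φ ∈ sp' X → ∀ b, gen X φ b ∈ skewAdjoint 𝔸)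
    (hbase : ∀ X φ, φ ∈ sp' X → ∀ b, base X φ b ∈ unitary 𝔸)
    (hbound : ∀ X φ, φ ∈ sp' X → ∀ b, ‖gen X φ b‖ ≤ p + q * (1 + D.dj X)) (hsp : ∀ X, TubeCfg ι 𝔸 a ⊆ sp X)
    (hE : ∀ X, DifferentiableOn ℂ (E X) (sp X)) (h0 : DerivZeroAlongV sp' E (expLine gen base))
    (hEb : B13.LogHalfBound D sp E nX B r) :
    B13.LogHalfBound D sp' (diffAlongV E (expLine gen base)) nX (8 * ((p + q) / a) ^ 2 * B) (r - 2) := by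
  have hκ : ∀ X, 0 < p + q * (1 + D.dj X) := fun X => by
    have hd := D.dj_nonneg X
    nlinarith [mul_nonneg hq hd]
  have hh : ∀ X, 0 < a / (p + q * (1 + D.dj X)) := fun X => div_pos ha (hκ X)
  have hH : ∀ X, (a / (p + q * (1 + D.dj X)))⁻¹ ≤ (p + q) / a * (1 + D.dj X) := fun X =>
    inv_halfWidth_le ha hp (D.dj_nonneg X)
  have hdom : LineInStrip sp' sp (expLine gen base) (fun X => a / (p + q * (1 + D.dj X))) :=
    lineInStrip_expLine (κ := fun X => p + q * (1 + D.dj X)) hgen hbase hκ hbound hsp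
  have han : AnalyticOnStrip sp' E (expLine gen base) (fun X => a / (p + q * (1 + D.dj X))) :=
    analyticOnStrip_expLine hE hdom
  exact logHalfBound_diffAlongV_of_derivZero hh hH hB hdom han h0 hEb

/-- **THE SAME IN THE LETTERS OF [II]** (`p = α₁`, `q = c₀·LM·α₀`, undifferenced per-LM-cube constant `A(LM)⁴`, tube
half-width `a` = the covariances' `α′₁`, printed R21): the differenced pieces obey the per-cube shape with the L,
M-INDEPENDENT constant `16A(1 + c₀²)/a²` at rate `r − 2` — `B10Eq61PerSite.logHalfBound_secondOrder_of_R21` with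
(L1′)+(L2′) discharged.  Remaining binders: generator skew-adjoint and bounded (HONEST SCOPE (ii): real `U_{k+1}`),
base unitary, `TubeCfg ι 𝔸 a ⊆ sp X` and holomorphy of the terms on `sp X` ([II] p. 15 by reference; WHICH space:
HONEST SCOPE (iii)), (L3′), the undifferenced bound. [cite: Balaban1988RG2Cluster, pp.15, 20–21; Balaban1985UV3, (29) p.263, (32) p.264, p.272] -/
theorem logHalfBound_secondOrder_expLine_of_R21 (c : B13.Consts) (h21 : c.R21) (hLM : 1 ≤ (c.L : ℝ) * c.M)
    (hα₀ : 0 ≤ c.α₀) (hα₁ : 0 < c.α₁) {A a c₀ r : ℝ} (hA : 0 ≤ A) (ha : 0 < a) (hc₀ : 0 ≤ c₀)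
    (hgen : ∀ X φ, φ ∈ sp' X → ∀ b, gen X φ b ∈ skewAdjoint 𝔸)
    (hbase : ∀ X φ, φ ∈ sp' X → ∀ b, base X φ b ∈ unitary 𝔸)
    (hbound : ∀ X φ, φ ∈ sp' X → ∀ b, ‖gen X φ b‖ ≤ c.α₁ + c₀ * ((c.L : ℝ) * c.M) * c.α₀ * (1 + D.dj X))
    (hsp : ∀ X, TubeCfg ι 𝔸 a ⊆ sp X) (hE : ∀ X, DifferentiableOn ℂ (E X) (sp X))
    (h0 : DerivZeroAlongV sp' E (expLine gen base))
    (hEb : B13.LogHalfBound D sp E nX (A * ((c.L : ℝ) * c.M) ^ 4) r) :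
    B13.LogHalfBound D sp' (diffAlongV E (expLine gen base)) nX (16 * A * (1 + c₀ ^ 2) / a ^ 2) (r - 2) := by
  have hLM0 : 0 ≤ (c.L : ℝ) * c.M := zero_le_one.trans hLM
  have hq : 0 ≤ c₀ * ((c.L : ℝ) * c.M) * c.α₀ := mul_nonneg (mul_nonneg hc₀ hLM0) hα₀
  have hκ : ∀ X, 0 < c.α₁ + c₀ * ((c.L : ℝ) * c.M) * c.α₀ * (1 + D.dj X) := fun X =>
    add_pos_of_pos_of_nonneg hα₁ (mul_nonneg hq (by linarith [D.dj_nonneg X]))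
  have hh : ∀ X, 0 < a / (c.α₁ + c₀ * ((c.L : ℝ) * c.M) * c.α₀ * (1 + D.dj X)) := fun X => div_pos ha (hκ X)
  have hH : ∀ X, (a / (c.α₁ + c₀ * ((c.L : ℝ) * c.M) * c.α₀ * (1 + D.dj X)))⁻¹ ≤
      (c.α₁ + c₀ * ((c.L : ℝ) * c.M) * c.α₀) / a * (1 + D.dj X) := fun X =>
    inv_halfWidth_le ha hα₁.le (D.dj_nonneg X)
  have hdom : LineInStrip sp' sp (expLine gen base)
      (fun X => a / (c.α₁ + c₀ * ((c.L : ℝ) * c.M) * c.α₀ * (1 + D.dj X))) :=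
    lineInStrip_expLine (κ := fun X => c.α₁ + c₀ * ((c.L : ℝ) * c.M) * c.α₀ * (1 + D.dj X))
      hgen hbase hκ hbound hsp
  have han : AnalyticOnStrip sp' E (expLine gen base)
      (fun X => a / (c.α₁ + c₀ * ((c.L : ℝ) * c.M) * c.α₀ * (1 + D.dj X))) :=
    analyticOnStrip_expLine hE hdom
  exact logHalfBound_secondOrder_of_R21 c h21 hLM hα₀ hα₁.le hA hh hH hdom han h0 hEb

/-- **(I.1.18) for the differenced pieces with an L, M-INDEPENDENT constant**, (L1′)+(L2′) discharged:
`B10Eq61PerSite.bound118_secondOrder_of_R21` along exponential lines — constant `(16A(1 + c₀²)/a²)·c₁`, rate `r − 3`.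
Same remaining binders plus the volume bound. [cite: Balaban1988RG2Cluster, p.21 (closing paragraph); Balaban1985UV3, (29) p.263, p.272] -/
theorem bound118_secondOrder_expLine_of_R21 (c : B13.Consts) (h21 : c.R21) (hLM : 1 ≤ (c.L : ℝ) * c.M)
    (hα₀ : 0 ≤ c.α₀) (hα₁ : 0 < c.α₁) {A a c₀ r c₁ : ℝ} (hA : 0 ≤ A) (ha : 0 < a) (hc₀ : 0 ≤ c₀)
    (hgen : ∀ X φ, φ ∈ sp' X → ∀ b, gen X φ b ∈ skewAdjoint 𝔸)
    (hbase : ∀ X φ, φ ∈ sp' X → ∀ b, base X φ b ∈ unitary 𝔸)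
    (hbound : ∀ X φ, φ ∈ sp' X → ∀ b, ‖gen X φ b‖ ≤ c.α₁ + c₀ * ((c.L : ℝ) * c.M) * c.α₀ * (1 + D.dj X))
    (hsp : ∀ X, TubeCfg ι 𝔸 a ⊆ sp X) (hE : ∀ X, DifferentiableOn ℂ (E X) (sp X))
    (h0 : DerivZeroAlongV sp' E (expLine gen base))
    (hEb : B13.LogHalfBound D sp E nX (A * ((c.L : ℝ) * c.M) ^ 4) r) (hvol : B13.VolBoundK1 D nX c₁)
    (hc₁ : 0 ≤ c₁) :
    B13.Bound118 D sp' (diffAlongV E (expLine gen base)) (16 * A * (1 + c₀ ^ 2) / a ^ 2 * c₁) (r - 3) := by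
  have hLM0 : 0 ≤ (c.L : ℝ) * c.M := zero_le_one.trans hLM
  have hq : 0 ≤ c₀ * ((c.L : ℝ) * c.M) * c.α₀ := mul_nonneg (mul_nonneg hc₀ hLM0) hα₀
  have hκ : ∀ X, 0 < c.α₁ + c₀ * ((c.L : ℝ) * c.M) * c.α₀ * (1 + D.dj X) := fun X =>
    add_pos_of_pos_of_nonneg hα₁ (mul_nonneg hq (by linarith [D.dj_nonneg X]))
  have hh : ∀ X, 0 < a / (c.α₁ + c₀ * ((c.L : ℝ) * c.M) * c.α₀ * (1 + D.dj X)) := fun X => div_pos ha (hκ X)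
  have hH : ∀ X, (a / (c.α₁ + c₀ * ((c.L : ℝ) * c.M) * c.α₀ * (1 + D.dj X)))⁻¹ ≤
      (c.α₁ + c₀ * ((c.L : ℝ) * c.M) * c.α₀) / a * (1 + D.dj X) := fun X =>
    inv_halfWidth_le ha hα₁.le (D.dj_nonneg X)
  have hdom : LineInStrip sp' sp (expLine gen base)
      (fun X => a / (c.α₁ + c₀ * ((c.L : ℝ) * c.M) * c.α₀ * (1 + D.dj X))) :=
    lineInStrip_expLine (κ := fun X => c.α₁ + c₀ * ((c.L : ℝ) * c.M) * c.α₀ * (1 + D.dj X))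
      hgen hbase hκ hbound hsp
  have han : AnalyticOnStrip sp' E (expLine gen base)
      (fun X => a / (c.α₁ + c₀ * ((c.L : ℝ) * c.M) * c.α₀ * (1 + D.dj X))) :=
    analyticOnStrip_expLine hE hdom
  exact bound118_secondOrder_of_R21 c h21 hLM hα₀ hα₁.le hA hh hH hdom han h0 hEb hvol hc₁

end secondOrder

/-! ## §5. [folklore] The holomorphy binder is of the resolvent kind -/

section resolvent

variable {𝔸 : Type*} [CStarAlgebra 𝔸]

/-- Along any differentiable `𝔸`-valued `T`, the inverse `ζ ↦ (T ζ)⁻¹` (`Ring.inverse`, the honest inverse on units)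
is differentiable at every `ζ` where `T ζ` is a unit — the one-variable holomorphy of a resolvent
`(x·1 + C*Δ(exp(ζK)U₀)C)⁻¹` of (63) along the line, given that of its argument (Mathlib `differentiableAt_inverse`).
[folklore] -/
theorem differentiableAt_inverse_comp {T : ℂ → 𝔸} {ζ : ℂ} (hT : DifferentiableAt ℂ T ζ) (hu : IsUnit (T ζ)) :
    DifferentiableAt ℂ (fun z => Ring.inverse (T z)) ζ :=
  (differentiableAt_inverse hu).comp ζ hT

/-- Ordered finite products of differentiable `𝔸`-valued functions are differentiable (`𝔸` non-commutative: a list,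
not a finset) — the shape of one random-walk term of (63), a product of `|ω| + O(1)` local factors. [folklore] -/
theorem differentiableAt_list_prod {l : List (ℂ → 𝔸)} {ζ : ℂ} (h : ∀ f ∈ l, DifferentiableAt ℂ f ζ) :
    DifferentiableAt ℂ (fun z => (l.map fun f => f z).prod) ζ := by
  induction l with
  | nil => simp
  | cons f l ih =>
    simp only [List.map_cons, List.prod_cons]
    exact (h f (by simp)).mul (ih fun g hg => h g (by simp [hg]))

/-- … and so is any continuous linear functional of such a product (in the matrix model: a matrix entry of the walk
term, cf. `B10Eq63Rep.continuousOn_prod_resolvent_entries`, the continuity version). [folklore] -/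
theorem differentiableAt_clm_list_prod (ℓ : 𝔸 →L[ℂ] ℂ) {l : List (ℂ → 𝔸)} {ζ : ℂ}
    (h : ∀ f ∈ l, DifferentiableAt ℂ f ζ) : DifferentiableAt ℂ (fun z => ℓ (l.map fun f => f z).prod) ζ :=
  ℓ.differentiableAt.comp ζ (differentiableAt_list_prod h)

end resolvent

/-! ## §6. Non-vacuity: all binders of `logHalfBound_expLine_of_derivZero` hold in a one-bond example over `𝔸 = ℂ` -/

section examples

/-- Example data: one bond (`ι = Unit`), `𝔸 = ℂ`; generator `(min ‖φ‖ 1)·i` (skew-adjoint, norm `≤ 1`, depending on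
the configuration), base point `1`. [folklore] -/
def exGen (_X : unitSys.Dom) (φ : Unit → ℂ) (_b : Unit) : ℂ := ((min ‖φ ()‖ 1 : ℝ) : ℂ) * Complex.I

/-- Example base point `1`. [folklore] -/
def exBase (_X : unitSys.Dom) (_φ : Unit → ℂ) (_b : Unit) : ℂ := 1

/-- Example family `E φ = (φ − 1)²` (holomorphic, non-constant, with vanishing first derivative at the base point).
[folklore] -/
def exE (_X : unitSys.Dom) (φ : Unit → ℂ) : ℂ := (φ () - 1) ^ 2

/-- The example generator is skew-adjoint. [folklore] -/
theorem exGen_mem_skewAdjoint (X : unitSys.Dom) (φ : Unit → ℂ) (b : Unit) : exGen X φ b ∈ skewAdjoint ℂ := by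
  have hr : star ((min ‖φ ()‖ 1 : ℝ) : ℂ) = ((min ‖φ ()‖ 1 : ℝ) : ℂ) := Complex.conj_ofReal _
  have hI : star Complex.I = -Complex.I := Complex.conj_I
  rw [skewAdjoint.mem_iff, exGen, star_mul', hr, hI, mul_neg]

/-- The example family is differentiable everywhere (hence holomorphic on any analyticity space). [folklore] -/
theorem differentiable_exE (X : unitSys.Dom) : Differentiable ℂ (exE X) := by
  show Differentiable ℂ (fun φ : Unit → ℂ => (φ () - 1) ^ 2)
  fun_prop

/-- The example generator has norm `≤ 1`. [folklore] -/
theorem norm_exGen_le (X : unitSys.Dom) (φ : Unit → ℂ) (b : Unit) : ‖exGen X φ b‖ ≤ 1 := by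
  rw [exGen, norm_mul, Complex.norm_I, mul_one, Complex.norm_real, Real.norm_eq_abs,
    abs_of_nonneg (le_min (norm_nonneg _) zero_le_one)]
  exact min_le_right _ _

/-- Points of the tube of half-width `1` in `ℂ` have norm `≤ 3` (`‖exp B‖ = e^{Re B} ≤ e ≤ 3`, `‖U‖ = 1`).
[folklore] -/
theorem norm_le_three_of_mem_tube {V : ℂ} (hV : V ∈ Tube ℂ 1) : ‖V‖ ≤ 3 := by
  obtain ⟨B, U, hB, hU, rfl⟩ := hV
  have hU1 : ‖U‖ = 1 := CStarRing.norm_of_mem_unitary hU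
  have hexp : ‖exp B‖ ≤ 3 := by
    rw [← congr_fun Complex.exp_eq_exp_ℂ B, Complex.norm_exp]
    have h1 : B.re ≤ 1 := (le_abs_self _).trans ((Complex.abs_re_le_norm B).trans hB.le)
    calc Real.exp B.re ≤ Real.exp 1 := Real.exp_le_exp.mpr h1
      _ ≤ 3 := by
        have := Real.exp_one_lt_d9
        linarith
  calc ‖exp B * U‖ ≤ ‖exp B‖ * ‖U‖ := norm_mul_le _ _
    _ ≤ 3 := by rw [hU1, mul_one]; exact hexp

/-- The undifferenced bound for the example family on the bondwise tube of half-width `1`: `‖(φ − 1)²‖ ≤ 16`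
(`nX ≡ 1`, rate `0`). [folklore] -/
theorem example_logHalfBound_exE :
    B13.LogHalfBound unitSys (fun _ => TubeCfg Unit ℂ 1) exE (fun _ => 1) 16 0 := by
  intro X φ hφ
  have hV : ‖φ ()‖ ≤ 3 := norm_le_three_of_mem_tube (hφ ())
  have h1 : ‖φ () - 1‖ ≤ 4 := (norm_sub_le _ _).trans (by rw [norm_one]; linarith)
  have h2 : ‖(φ () - 1) ^ 2‖ ≤ 16 := by
    rw [norm_pow]
    nlinarith [norm_nonneg (φ () - 1)]
  simpa [exE] using h2

/-- (L3′) for the example, non-trivially: `d/dζ (exp(ζk) − 1)² = 2(exp(0) − 1)·k = 0` at `ζ = 0`. [folklore] -/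
theorem example_derivZeroAlongV :
    DerivZeroAlongV (D := unitSys) (fun _ => univ) exE (expLine exGen exBase) := by
  intro X φ _
  have h1 : HasDerivAt (fun ζ : ℂ => exp (ζ • exGen X φ ()) * exBase X φ ())
      (exp ((0 : ℂ) • exGen X φ ()) * exGen X φ () * exBase X φ ()) 0 :=
    (hasDerivAt_exp_smul_const (exGen X φ ()) 0).mul_const _
  have h2 : HasDerivAt (fun ζ : ℂ => (exp (ζ • exGen X φ ()) * exBase X φ () - 1) ^ 2)
      (((2 : ℕ) : ℂ) * (exp ((0 : ℂ) • exGen X φ ()) * exBase X φ () - 1) ^ (2 - 1) *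
        (exp ((0 : ℂ) • exGen X φ ()) * exGen X φ () * exBase X φ ())) 0 :=
    (h1.sub_const 1).pow 2
  show deriv (fun ζ : ℂ => (exp (ζ • exGen X φ ()) * exBase X φ () - 1) ^ 2) 0 = 0
  rw [h2.deriv]
  simp [exBase]

/-- **Non-vacuity of §4**: with evaluation space = all configurations, analyticity space = the bondwise tube of
half-width `a = 1`, `p = 1`, `q = 0`, `B = 16`, `r = 0`, every binder of `logHalfBound_expLine_of_derivZero` holds and
it yields the differenced bound with constant `8·((1 + 0)/1)²·16`. [folklore] -/
theorem example_logHalfBound_expLine :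
    B13.LogHalfBound unitSys (fun _ => univ) (diffAlongV exE (expLine exGen exBase)) (fun _ => 1)
      (8 * ((1 + 0) / 1) ^ 2 * 16) (0 - 2) :=
  logHalfBound_expLine_of_derivZero (sp := fun _ => TubeCfg Unit ℂ 1) one_pos zero_le_one le_rfl
    (by norm_num) (by norm_num) (fun X φ _ b => exGen_mem_skewAdjoint X φ b)
    (fun _ _ _ _ => by simp [exBase])
    (fun X φ _ b => by simpa using norm_exGen_le X φ b) (fun _ => Subset.rfl)
    (fun X => (differentiable_exE X).differentiableOn) example_derivZeroAlongV example_logHalfBound_exE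

end examples

/-! ## §7. The paper's setting `G = U(N) ⊂ M_N(ℂ)` with the operator norm is an instance of the model -/

section matrices

open scoped Matrix.Norms.L2Operator

/-- `M_N(ℂ)` with the `L²`-operator norm (scope `Matrix.Norms.L2Operator`) is a unital C⋆-algebra (all structure from
Mathlib's scoped instances; cf. `…B7Prop2Explicit` §6, which builds the same structure with `letI`).  A `def`, NOT a
global instance: the cell's matrix modules choose their norms locally. [folklore] -/
@[reducible] def cstarAlgebraMatrix (N : ℕ) : CStarAlgebra (Matrix (Fin N) (Fin N) ℂ) := {}

/-- **§1 in the paper's setting**: for a skew-Hermitian `K ∈ 𝔲(N)` (`K† = −K`, i.e. `K = iH`, `H` Hermitian — the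
`iη𝓗(B)` of (29) at one bond) and `U₀ ∈ U(N)` (`Matrix.unitaryGroup (Fin N) ℂ = unitary M_N(ℂ)`), `|Im ζ|·‖K‖ < α`
puts `exp(ζK)·U₀` in the tube `{exp(B)·U : ‖B‖ < α, U ∈ U(N)}` (operator norms; the tube of `M_N(ℂ)` with the
structure `cstarAlgebraMatrix N`). [cite: Balaban1985UV3, (29) p.263; Balaban1987RG1, (1.12)–(1.13) p.262] -/
theorem exp_smul_mul_mem_tube_unitaryGroup (N : ℕ) {K U₀ : Matrix (Fin N) (Fin N) ℂ}
    (hK : K ∈ skewAdjoint (Matrix (Fin N) (Fin N) ℂ)) (hU₀ : U₀ ∈ Matrix.unitaryGroup (Fin N) ℂ) {ζ : ℂ} {α : ℝ}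
    (hζ : |ζ.im| * ‖K‖ < α) :
    exp (ζ • K) * U₀ ∈ @Tube (Matrix (Fin N) (Fin N) ℂ) (cstarAlgebraMatrix N) α :=
  @exp_smul_mul_mem_tube _ (cstarAlgebraMatrix N) _ _ hK hU₀ _ _ hζ

end matrices

end Literature.MathematicalPhysics.QuantumFieldTheory.Balaban1983to89.B10Eq29TubeLine
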